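import Mathlib
import Literature.Combinatorics.StablePolynomials.NegativeCorrelation

/-!
# `NoHeavyLowerTail` (stmt-CriticalPhenomena-4575) — no-go: the pattern polynomial of positively correlated
# events is never real stable (the Borcea–Brändén–Liggett lane is orthogonal to Sahi's `E`-hierarchy)

Support file of the `|A| = 5` / master-family surge, seat `prim-l12-p5` (technique lane: Lorentzian / stable
polynomials), `--supports stmt-CriticalPhenomena-4575`.  Everything PROVED; no definitions, no named facts.

QUESTION PUT TO THIS LANE (coordinator brief, prim-l12 P5): is `L1/L2` (polarised E3GRP) or Sahi's `C₃` a
Rayleigh / Lorentzian consequence for the generating polynomial of the event indicators of a down-set (or up-set) triple?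

ANSWER, part 1 (this file).  Let `μ` be a probability weight on a finite type `Ω` and `A_i ⊆ Ω` (`i ∈ σ`) events.  The
PATTERN LAW is `c(S) = μ{ω : {i | ω ∈ A_i} = S}` (`S ⊆ σ`) and the pattern (partition-function-with-marks) polynomial is
`P(z) = Σ_S c(S) z^S = E_μ Π_i z_i^{𝟙_{A_i}}` (`= E Π (1 + s_i 𝟙_{A_i})` at `z = 1 + s`, the moment polynomial whose
coefficients are the joint moments `μ(⋂_{i∈S} A_i)` entering `E_n`).  Real stability of `P` (= strongly Rayleigh, the
Borcea–Brändén–Liggett class) forces PAIRWISE NEGATIVE correlation `μ(A_x ∩ A_y) ≤ μ(A_x)μ(A_y)` (tree: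
`Literature.Combinatorics.StablePolynomials.multiAffine_pairwise_negCorr`, [BorceaBrandenLiggett2007, §2.1, §4.1]).  Hence:

* `not_stable_of_posCorr` — if some pair is strictly positively correlated in the pattern law, `P` is NOT real stable;
* `sum_patternLaw_filter_mem`, `sum_patternLaw_filter_mem_and`, `sum_patternLaw` — the marginals of the pattern law are
  `μ(A_x)`, `μ(A_x ∩ A_y)`, `1`;
* **`patternPoly_not_realStable_of_posCorr`** — for events with `μ(A_x)μ(A_y) < μ(A_x ∩ A_y)` (strict Harris, which is
  the GENERIC case for two increasing events of a product measure / two connection events of percolation), the pattern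
  polynomial `multiAffine c`, `c` = pattern law, is not real stable.

So for monotone event families the stable/Rayleigh machinery applies only in the independent (product) corner, where all
`E_n` vanish identically; `C₃`, E3GRP, `L1/L2` are not Rayleigh consequences.  Smallest instance: ONE bit `x ∼ Bern(q)`,
`A₁ = Ω`, `A₂ = A₃ = {x = 1}`: `c(∅)=0, c({1}) = 1−q, c({1,2,3}) = q`, `P = z₁((1−q) + q z₂z₃)`, and `z₂z₃ = −(1−q)/q`
has solutions in `H²`.  (Part 2, the Lorentzian signature test and the M-convexity of supports, and part 3, what DOES
survive — log-convexity / Stieltjes structure on the diagonal — are in `…SahiDiagonalHankel` and the seat report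
run/shared/lean/prim/prim-l12/prim-l12-p5/P5-REPORT.md.)
-/

noncomputable section

namespace Summit.CriticalPhenomena.PercolationContinuityZ3.Theorems

namespace PatternPolynomialNoGo

open Finset Literature.Combinatorics.StablePolynomials
open scoped BigOperators

variable {σ : Type*} [Fintype σ] [DecidableEq σ]

/-- **Abstract no-go.** For a real coefficient family `c` on `2^σ` of total mass `1`, strict positive correlation of
the pair `x ≠ y` in the sense `(Σ_{S ∋ x} c)(Σ_{S ∋ y} c) < Σ_{S ∋ x,y} c` is incompatible with the half-plane property
of `Σ_S c(S) z^S` (contrapositive of Borcea–Brändén–Liggett's "strongly Rayleigh ⇒ pairwise negatively correlated").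
[cite: BorceaBrandenLiggett2007, §2.1 and §4.1] -/
theorem not_stable_of_posCorr (c : Finset σ → ℝ) (hsum : ∑ S, c S = 1) {x y : σ} (hxy : x ≠ y)
    (hpos : (∑ S ∈ univ.filter (fun S : Finset σ => x ∈ S), c S) *
        (∑ S ∈ univ.filter (fun S : Finset σ => y ∈ S), c S) <
      ∑ S ∈ univ.filter (fun S : Finset σ => x ∈ S ∧ y ∈ S), c S) :
    ¬ ∀ z : σ → ℂ, (∀ i, 0 < (z i).im) → (∑ S : Finset σ, (c S : ℂ) * ∏ i ∈ S, z i) ≠ 0 := by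
  intro hst
  have h := multiAffine_pairwise_negCorr c (Or.inr hst) hxy
  rw [hsum, mul_one] at h
  linarith

/-- The same with the tree's predicate: `multiAffine c` is not real stable. [cite: BorceaBrandenLiggett2007, §2.1 and §4.1] -/
theorem not_isRealStable_of_posCorr (c : Finset σ → ℝ) (hsum : ∑ S, c S = 1) {x y : σ} (hxy : x ≠ y)
    (hpos : (∑ S ∈ univ.filter (fun S : Finset σ => x ∈ S), c S) *
        (∑ S ∈ univ.filter (fun S : Finset σ => y ∈ S), c S) <
      ∑ S ∈ univ.filter (fun S : Finset σ => x ∈ S ∧ y ∈ S), c S) :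
    ¬ IsRealStable (multiAffine c) := by
  rw [isRealStable_multiAffine_iff]
  exact not_stable_of_posCorr c hsum hxy hpos

/-! ### The pattern law of a family of events under a weight -/

variable {Ω : Type*} [Fintype Ω] [DecidableEq Ω]

/-- In the statements below the **pattern law** of the events `A_i` under the weight `μ`,
`c(S) = μ{ω : {i | ω ∈ A_i} = S}`, is written out as the finite sum
`∑ ω, if univ.filter (fun i => ω ∈ A i) = S then μ ω else 0` (no auxiliary definition is introduced). -/
example : True := trivial

/-- Summing the pattern law against a test `φ(S)` evaluates `φ` at the pattern of `ω`. [folklore] -/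
theorem sum_patternLaw_mul (μ : Ω → ℝ) (A : σ → Finset Ω) (φ : Finset σ → ℝ) :
    ∑ S, (∑ ω, if univ.filter (fun i => ω ∈ A i) = S then μ ω else 0) * φ S = ∑ ω, μ ω * φ (univ.filter fun i => ω ∈ A i) := by
  simp only [Finset.sum_mul]
  rw [Finset.sum_comm]
  refine Finset.sum_congr rfl fun ω _ => ?_
  simp only [ite_mul, zero_mul]
  rw [Finset.sum_ite_eq univ (univ.filter fun i => ω ∈ A i) (fun S => μ ω * φ S), if_pos (mem_univ _)]

/-- A filtered sum of the pattern law is the weight of the event "the pattern satisfies `p`". [folklore] -/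
theorem sum_filter_patternLaw (μ : Ω → ℝ) (A : σ → Finset Ω) (p : Finset σ → Prop) [DecidablePred p] :
    ∑ S ∈ univ.filter p, (∑ ω, if univ.filter (fun i => ω ∈ A i) = S then μ ω else 0) =
      ∑ ω, μ ω * (if p (univ.filter fun i => ω ∈ A i) then 1 else 0) := by
  rw [Finset.sum_filter]
  have : ∀ S : Finset σ, (if p S then (∑ ω, if univ.filter (fun i => ω ∈ A i) = S then μ ω else 0) else 0) =
      (∑ ω, if univ.filter (fun i => ω ∈ A i) = S then μ ω else 0) * (if p S then 1 else 0) :=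
    fun S => by split_ifs <;> simp
  simp_rw [this]
  exact sum_patternLaw_mul μ A _

/-- Marginal: `Σ_{S ∋ x} c(S) = μ(A_x)`. [folklore] -/
theorem sum_patternLaw_filter_mem (μ : Ω → ℝ) (A : σ → Finset Ω) (x : σ) :
    ∑ S ∈ univ.filter (fun S : Finset σ => x ∈ S), (∑ ω, if univ.filter (fun i => ω ∈ A i) = S then μ ω else 0) =
      ∑ ω ∈ A x, μ ω := by
  rw [sum_filter_patternLaw]
  simp only [Finset.mem_filter, Finset.mem_univ, true_and, mul_ite, mul_one, mul_zero]
  rw [← Finset.sum_filter, Finset.filter_univ_mem]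

/-- Pair marginal: `Σ_{S ∋ x, y} c(S) = μ(A_x ∩ A_y)`. [folklore] -/
theorem sum_patternLaw_filter_mem_and (μ : Ω → ℝ) (A : σ → Finset Ω) (x y : σ) :
    ∑ S ∈ univ.filter (fun S : Finset σ => x ∈ S ∧ y ∈ S),
      (∑ ω, if univ.filter (fun i => ω ∈ A i) = S then μ ω else 0) = ∑ ω ∈ A x ∩ A y, μ ω := by
  rw [sum_filter_patternLaw]
  simp only [Finset.mem_filter, Finset.mem_univ, true_and, mul_ite, mul_one, mul_zero]
  rw [← Finset.sum_filter]
  have h : univ.filter (fun ω => ω ∈ A x ∧ ω ∈ A y) = A x ∩ A y := by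
    ext ω
    simp
  rw [h]

/-- Total mass: `Σ_S c(S) = Σ μ`. [folklore] -/
theorem sum_patternLaw (μ : Ω → ℝ) (A : σ → Finset Ω) :
    ∑ S, (∑ ω, if univ.filter (fun i => ω ∈ A i) = S then μ ω else 0) = ∑ ω, μ ω := by
  have h := sum_patternLaw_mul μ A (fun _ => 1)
  simpa using h

/-- **No-go for the `E`-hierarchy.** If two of the events are STRICTLY positively correlated under a probability weight
(`μ(A_x)μ(A_y) < μ(A_x ∩ A_y)` — strict Harris, the generic case for increasing events of a product measure or
connection events in percolation), then the pattern polynomial `Σ_S μ(pattern = S) z^S = E Π_i z_i^{𝟙_{A_i}}` is not real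
stable; in particular it is not strongly Rayleigh, and no inequality of that theory (all of which express NEGATIVE
dependence) can yield `C₃`, E3GRP or `L1/L2`. [cite: BorceaBrandenLiggett2007, §2.1 and §4.1] -/
theorem patternPoly_not_realStable_of_posCorr (μ : Ω → ℝ) (hμ : ∑ ω, μ ω = 1) (A : σ → Finset Ω) {x y : σ}
    (hxy : x ≠ y) (hpos : (∑ ω ∈ A x, μ ω) * (∑ ω ∈ A y, μ ω) < ∑ ω ∈ A x ∩ A y, μ ω) :
    ¬ IsRealStable (multiAffine fun S : Finset σ =>
      ∑ ω, if univ.filter (fun i => ω ∈ A i) = S then μ ω else 0) := by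
  refine not_isRealStable_of_posCorr _ ((sum_patternLaw μ A).trans hμ) hxy ?_
  rwa [sum_patternLaw_filter_mem, sum_patternLaw_filter_mem, sum_patternLaw_filter_mem_and]

end PatternPolynomialNoGo

end Summit.CriticalPhenomena.PercolationContinuityZ3.Theorems
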